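import Summits.AtomisticToContinuum.HydrodynamicLimit.Theses.InformationPercolationEngine
import Summits.AtomisticToContinuum.HydrodynamicLimit.Theses.TwoClocks
import Summits.AtomisticToContinuum.HydrodynamicLimit.Theses.LimitCollisionMeasure
import Summits.AtomisticToContinuum.HydrodynamicLimit.Theorems.InformationPercolationEngineKineticClosureBridge
import Summits.AtomisticToContinuum.HydrodynamicLimit.Theorems.InformationPercolationEngineChaosClosesEulerReductionFields
import Summits.AtomisticToContinuum.HydrodynamicLimit.Theorems.InformationPercolationEngineChaosClosesEulerReadoutMeasurable
import Summits.AtomisticToContinuum.HydrodynamicLimit.Theorems.InformationPercolationEngineChaosClosesEulerEnskogTensor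
import Summits.AtomisticToContinuum.HydrodynamicLimit.Theorems.InformationPercolationEngineChaosClosesEulerPressureValueO
import HarnessLib

/-!
# The collisional pressure value in band from pointwise Enskog collision statistics

Helper for the line `Sketch` of the crux `InformationPercolationEngine.ChaosClosesEuler`
(stmt-AtomisticToContinuum-15141), skeleton v11 (`Cruxes/ChaosClosesEuler/Lines/Sketch.lean`), registered stub
`stub_pressureValueOfEnskog`: `MaxwellianMoments → PointwiseLocalEquilibrium → PointwiseEnskogCollisions → TwoClocks.EnergyCurrentTails → LimitCollisionMeasure.CollisionTightness → CollisionMomentUI → CollisionalPressureValueInBand` (bodies VERBATIM the skeleton defs).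

PROOF. `η₀ :=` the least of the bands of pointwise local equilibrium, of the pointwise Enskog collision
statistics and of the contact-value clamp (`EvenStressEnskog.exists_contactValue_clamp`); `σ₀ :=` the least of the
four thresholds and `1/2`; at fixed `(σ, T, ρ, θ, u, Φ, t)` the estimate is
`ChaosClosesEulerPressureValue.pressureValue_inProbability` (helper O; helpers A–N: velocity truncation of the stress
mark, the deviatoric split and the equation-of-state identity, the time tent and the smoothed coefficient, the
collision-sum calculus and the layer inequality, Fubini and the window transpose, the Enskog-side and the
collision-side estimates along a good orbit, the pathwise core with the landed stress-isotropy estimate, bridging and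
the budget).  `CollisionTightness` is not used.

References: lead NOTES `Cruxes/ChaosClosesEuler/NOTES.md` §F3; P. Résibois, M. De Leener (1977) Ch. VI §3; H. van Beijeren, M. H. Ernst, Physica 68 (1973).
-/

noncomputable section

namespace Summit.AtomisticToContinuum.HydrodynamicLimit.Theorems.ChaosClosesEulerPressureValue

open scoped BigOperators Topology Classical MeasureTheory ENNReal InnerProductSpace
open Filter Set MeasureTheory
open Literature.MathematicalPhysics.KineticTheory
open Literature.Analysis.FluidPDE
open Summit.AtomisticToContinuum.HydrodynamicLimit.Theses
open Summit.AtomisticToContinuum.HydrodynamicLimit.Theses.InformationPercolationEngine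

/-- Registered stub `stub_pressureValueOfEnskog` of skeleton v11 (line `Sketch`, crux stmt-AtomisticToContinuum-15141): `MaxwellianMoments → PointwiseLocalEquilibrium → PointwiseEnskogCollisions → TwoClocks.EnergyCurrentTails → LimitCollisionMeasure.CollisionTightness → CollisionMomentUI → CollisionalPressureValueInBand` (bodies VERBATIM the skeleton defs). [folklore] -/
theorem stub_pressureValueOfEnskog :
    (∀ (ρ θ : ℝ) (u : V3), 0 < ρ → 0 < θ →
      let m : Measure V3 := volume.withDensity (fun v => ENNReal.ofReal (localMaxwellian ρ θ u v))
      IsFiniteMeasure m ∧ Integrable (fun v : V3 => ‖v‖ ^ 2) m ∧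
      (m Set.univ).toReal = ρ ∧ (∀ j : Fin 3, ∫ v, v j ∂m = ρ * u j) ∧
      (∀ j k : Fin 3, ∫ v, v j * v k ∂m = ρ * (u j * u k + if j = k then θ else 0)) ∧
      (∫ v, ‖v‖ ^ 2 ∂m = ρ * (‖u‖ ^ 2 + 3 * θ)) ∧
      (∀ ψ : V3 → ℝ, Continuous ψ → (∃ C : ℝ, ∀ v, |ψ v| ≤ C) →
        Integrable ψ m ∧ ∫ v, ψ v ∂m = ρ * ∫ v, ψ v * localMaxwellian 1 θ u v)) →
    (∃ η₀ : ℝ, 0 < η₀ ∧ ∀ (a₀ θ₀ : T3 → ℝ) (u₀ : T3 → V3), Continuous a₀ → Continuous θ₀ → Continuous u₀ →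
      (∀ x, 0 < a₀ x) → (∀ x, 0 < θ₀ x) → ∃ σ₀ : ℝ, 0 < σ₀ ∧ ∀ σ : ℝ, 0 < σ → σ < σ₀ →
      ∀ (T : ℝ) (ρ θ : ℝ → T3 → ℝ) (u : ℝ → T3 → V3), IsHardSphereEulerSolution σ T ρ u θ →
      ∀ Φ : (N : ℕ) → HardSphereFlow (Torus.geometry (Fin 3)) (hsDiameter σ N) (N + 1),
      TendstoHydroFieldsAt (fun N => localGibbsLaw σ a₀ u₀ θ₀ N (Φ N)) Φ ρ u θ 0 →
      ∀ t ∈ Set.Ico 0 T, ∀ ψ : V3 → ℝ, Continuous ψ → (∃ C : ℝ, ∀ v, |ψ v| ≤ C) →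
      ∀ h : ℝ × V3 × ℝ → ℝ, Continuous h → (∃ C : ℝ, ∀ p, |h p| ≤ C) →
      (∃ ρ₁ θ₁ Θ U : ℝ, 0 < ρ₁ ∧ 0 < θ₁ ∧ ∀ p : ℝ × V3 × ℝ,
        (p.1 ≤ ρ₁ ∨ η₀ ≤ σ ^ 3 * p.1 ∨ p.2.2 ≤ θ₁ ∨ Θ ≤ p.2.2 ∨ U ≤ ‖p.2.1‖) → h p = 0) →
      ∀ η δ : ℝ, 0 < η → 0 < δ → ∃ r₀ : ℝ, 0 < r₀ ∧ ∀ r : ℝ, 0 < r → r < r₀ → ∃ N₀ : ℕ, ∀ N : ℕ, N₀ ≤ N →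
      let bx : T3 → T3 → ℝ := fun y x => 3 / (Real.pi * r ^ 3) * max (1 - Torus.euclidDist y x / r) 0
      let ρm : Config (N + 1) (Fin 3) T3 → T3 → ℝ := fun w x₀ => ∫ q, bx q.1 x₀ ∂(empiricalMeasure w)
      let mm : Config (N + 1) (Fin 3) T3 → T3 → V3 := fun w x₀ => ∫ q, bx q.1 x₀ • q.2 ∂(empiricalMeasure w)
      let em : Config (N + 1) (Fin 3) T3 → T3 → ℝ := fun w x₀ =>
        ∫ q, bx q.1 x₀ * (‖q.2‖ ^ 2 / 2) ∂(empiricalMeasure w)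
      let um : Config (N + 1) (Fin 3) T3 → T3 → V3 := fun w x₀ => (ρm w x₀)⁻¹ • mm w x₀
      let θm : Config (N + 1) (Fin 3) T3 → T3 → ℝ := fun w x₀ =>
        2 / 3 * (em w x₀ / ρm w x₀ - ‖mm w x₀‖ ^ 2 / (2 * ρm w x₀ ^ 2))
      let Mψ : Config (N + 1) (Fin 3) T3 → T3 → ℝ := fun w x₀ => ∫ q, bx q.1 x₀ * ψ q.2 ∂(empiricalMeasure w)
      localGibbsLaw σ a₀ u₀ θ₀ N (Φ N)
        {z | η < ∫ s in Set.Icc 0 t, ∫ x,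
          |h (ρm ((Φ N).flow s z) x, um ((Φ N).flow s z) x, θm ((Φ N).flow s z) x)| *
            |Mψ ((Φ N).flow s z) x - ρm ((Φ N).flow s z) x *
              ∫ v, ψ v * localMaxwellian 1 (θm ((Φ N).flow s z) x) (um ((Φ N).flow s z) x) v|} ≤ ENNReal.ofReal δ) →
    (∃ η₀ : ℝ, 0 < η₀ ∧ ∀ (a₀ θ₀ : T3 → ℝ) (u₀ : T3 → V3), Continuous a₀ → Continuous θ₀ → Continuous u₀ →
      (∀ x, 0 < a₀ x) → (∀ x, 0 < θ₀ x) → ∃ σ₀ : ℝ, 0 < σ₀ ∧ ∀ σ : ℝ, 0 < σ → σ < σ₀ →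
      ∀ Φ : (N : ℕ) → HardSphereFlow (Torus.geometry (Fin 3)) (hsDiameter σ N) (N + 1),
      ∀ τ : ℝ, 0 < τ → ∀ G : V3 × V3 × V3 → ℝ, Continuous G → (∃ C : ℝ, ∀ p, |G p| ≤ C) →
      ∀ h : ℝ × V3 × ℝ → ℝ, Continuous h → (∃ C : ℝ, ∀ p, |h p| ≤ C) →
      (∀ p : ℝ × V3 × ℝ, η₀ ≤ σ ^ 3 * p.1 → h p = 0) →
      ∀ η δ : ℝ, 0 < η → 0 < δ → ∃ r₀ : ℝ, 0 < r₀ ∧ ∀ r : ℝ, 0 < r → r < r₀ → ∃ N₀ : ℕ, ∀ N : ℕ, N₀ ≤ N →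
      let ε := hsDiameter σ N
      let Gm : Geometry (Fin 3) T3 := Torus.geometry (Fin 3)
      let γ : Config (N + 1) (Fin 3) T3 → ℝ → Config (N + 1) (Fin 3) T3 := fun z s => (Φ N).flow s z
      let bx : T3 → T3 → ℝ := fun y x => 3 / (Real.pi * r ^ 3) * max (1 - Torus.euclidDist y x / r) 0
      let bt : ℝ → ℝ := fun a => r⁻¹ * max (1 - |a| / r) 0
      let ρm : Config (N + 1) (Fin 3) T3 → T3 → ℝ := fun w x₀ => ∫ q, bx q.1 x₀ ∂(empiricalMeasure w)
      let mm : Config (N + 1) (Fin 3) T3 → T3 → V3 := fun w x₀ => ∫ q, bx q.1 x₀ • q.2 ∂(empiricalMeasure w)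
      let em : Config (N + 1) (Fin 3) T3 → T3 → ℝ := fun w x₀ =>
        ∫ q, bx q.1 x₀ * (‖q.2‖ ^ 2 / 2) ∂(empiricalMeasure w)
      let um : Config (N + 1) (Fin 3) T3 → T3 → V3 := fun w x₀ => (ρm w x₀)⁻¹ • mm w x₀
      let θm : Config (N + 1) (Fin 3) T3 → T3 → ℝ := fun w x₀ =>
        2 / 3 * (em w x₀ / ρm w x₀ - ‖mm w x₀‖ ^ 2 / (2 * ρm w x₀ ^ 2))
      let Hw : Config (N + 1) (Fin 3) T3 → T3 → ℝ := fun w x => h (ρm w x, um w x, θm w x)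
      let Θ : V3 → V3 → ℝ := fun v w =>
        ∫ ω : Metric.sphere (0 : V3) 1, G ((ω : V3), v, w) * hardSphereKernel (w, v) ω ∂sphereMeasure
      let BG : Config (N + 1) (Fin 3) T3 → T3 → ℝ := fun w x₀ =>
        ∫ p, bx p.1.1 x₀ * bx p.2.1 x₀ * Θ p.1.2 p.2.2 ∂((empiricalMeasure w).prod (empiricalMeasure w))
      let pv : Config (N + 1) (Fin 3) T3 → ℝ → Fin (N + 1) → Fin (N + 1) → V3 × V3 := fun z s i j =>
        reflectVel (Gm.sepVec (γ z s i).1 (γ z s j).1) ((γ z s i).2, (γ z s j).2)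
      let Y : ℝ → ℝ := fun a => 3 / (2 * Real.pi) * deriv hsExcessFreeEnergy a
      let Kr : Config (N + 1) (Fin 3) T3 → ℝ → T3 → ℝ := fun z t₀ x₀ =>
        ε / (N + 1 : ℝ) * ∑ᶠ (s : ℝ) (_ : s ∈ collisionTimes Gm ε (γ z) ∩ Set.Icc 0 τ),
          ∑ i : Fin (N + 1), ∑ j : Fin (N + 1),
            (if i ≠ j ∧ ‖Gm.sepVec (γ z s i).1 (γ z s j).1‖ = ε then
              bt (s - t₀) * bx (γ z s i).1 x₀ * Hw (γ z s) (γ z s i).1 *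
                G (ε⁻¹ • Gm.sepVec (γ z s i).1 (γ z s j).1, (pv z s i j).1, (pv z s i j).2) else 0)
      let R : Config (N + 1) (Fin 3) T3 → ℝ → T3 → ℝ := fun z t₀ x₀ =>
        σ ^ 3 * ∫ s in Set.Icc 0 τ, bt (s - t₀) *
          ∫ x, bx x x₀ * (Hw (γ z s) x * Y (σ ^ 3 * ρm (γ z s) x) * BG (γ z s) x)
      localGibbsLaw σ a₀ u₀ θ₀ N (Φ N)
        {z | η < ∫ t₀ in Set.Icc 0 τ, ∫ x₀, |Kr z t₀ x₀ - R z t₀ x₀|} ≤ ENNReal.ofReal δ) →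
    TwoClocks.EnergyCurrentTails → LimitCollisionMeasure.CollisionTightness →
    (∀ (a₀ θ₀ : T3 → ℝ) (u₀ : T3 → V3), Continuous a₀ → Continuous θ₀ → Continuous u₀ →
      (∀ x, 0 < a₀ x) → (∀ x, 0 < θ₀ x) → ∃ σ₀ : ℝ, 0 < σ₀ ∧ ∀ σ : ℝ, 0 < σ → σ < σ₀ →
      ∀ Φ : (N : ℕ) → HardSphereFlow (Torus.geometry (Fin 3)) (hsDiameter σ N) (N + 1),
      ∀ τ : ℝ, 0 < τ → ∀ η δ : ℝ, 0 < η → 0 < δ → ∃ L : ℝ, ∃ N₀ : ℕ, ∀ N : ℕ, N₀ ≤ N →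
      let ε := hsDiameter σ N
      let G : Geometry (Fin 3) T3 := Torus.geometry (Fin 3)
      let γ : Config (N + 1) (Fin 3) T3 → ℝ → Config (N + 1) (Fin 3) T3 := fun z s => (Φ N).flow s z
      let Kc : (Config (N + 1) (Fin 3) T3 → ℝ → Fin (N + 1) → Fin (N + 1) → ℝ) → Config (N + 1) (Fin 3) T3 → ℝ := fun F z =>
        ε / (N + 1 : ℝ) * ∑ᶠ (s : ℝ) (_ : s ∈ collisionTimes G ε (γ z) ∩ Set.Icc 0 τ),
          ∑ i : Fin (N + 1), ∑ j : Fin (N + 1),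
            (if i ≠ j ∧ ‖G.sepVec (γ z s i).1 (γ z s j).1‖ = ε then F z s i j else 0)
      localGibbsLaw σ a₀ u₀ θ₀ N (Φ N)
          {z | η < Kc (fun z s i j => if L < ‖(γ z s i).2‖ ^ 2 + ‖(γ z s j).2‖ ^ 2 then
            1 + ‖(γ z s i).2‖ ^ 2 + ‖(γ z s j).2‖ ^ 2 else 0) z} ≤ ENNReal.ofReal δ) →
    ∃ η₀ : ℝ, 0 < η₀ ∧ ∀ (a₀ θ₀ : T3 → ℝ) (u₀ : T3 → V3), Continuous a₀ → Continuous θ₀ → Continuous u₀ →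
      (∀ x, 0 < a₀ x) → (∀ x, 0 < θ₀ x) → ∃ σ₀ : ℝ, 0 < σ₀ ∧ ∀ σ : ℝ, 0 < σ → σ < σ₀ →
      ∀ (T : ℝ) (ρ θ : ℝ → T3 → ℝ) (u : ℝ → T3 → V3), IsHardSphereEulerSolution σ T ρ u θ →
      ∀ Φ : (N : ℕ) → HardSphereFlow (Torus.geometry (Fin 3)) (hsDiameter σ N) (N + 1),
      TendstoHydroFieldsAt (fun N => localGibbsLaw σ a₀ u₀ θ₀ N (Φ N)) Φ ρ u θ 0 →
      ∀ t ∈ Set.Ico 0 T, ∀ a : Fin 3 → Fin 3 → ℝ × T3 → ℝ, (∀ j k, Continuous (a j k)) →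
      (∀ j k p, a j k p = a k j p) →
      ∀ g : ℝ → ℝ, Continuous g → (∀ b, η₀ ≤ b → g b = 0) →
      ∀ η δ : ℝ, 0 < η → 0 < δ → ∃ r₀ : ℝ, 0 < r₀ ∧ ∀ r : ℝ, 0 < r → r < r₀ → ∃ N₀ : ℕ, ∀ N : ℕ, N₀ ≤ N →
      let ε := hsDiameter σ N
      let G : Geometry (Fin 3) T3 := Torus.geometry (Fin 3)
      let γ : Config (N + 1) (Fin 3) T3 → ℝ → Config (N + 1) (Fin 3) T3 := fun z s => (Φ N).flow s z
      let bx : T3 → T3 → ℝ := fun y x => 3 / (Real.pi * r ^ 3) * max (1 - Torus.euclidDist y x / r) 0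
      let ρm : Config (N + 1) (Fin 3) T3 → T3 → ℝ := fun w x₀ => ∫ q, bx q.1 x₀ ∂(empiricalMeasure w)
      let mm : Config (N + 1) (Fin 3) T3 → T3 → V3 := fun w x₀ => ∫ q, bx q.1 x₀ • q.2 ∂(empiricalMeasure w)
      let em : Config (N + 1) (Fin 3) T3 → T3 → ℝ := fun w x₀ =>
        ∫ q, bx q.1 x₀ * (‖q.2‖ ^ 2 / 2) ∂(empiricalMeasure w)
      let θm : Config (N + 1) (Fin 3) T3 → T3 → ℝ := fun w x₀ =>
        2 / 3 * (em w x₀ / ρm w x₀ - ‖mm w x₀‖ ^ 2 / (2 * ρm w x₀ ^ 2))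
      let pv : Config (N + 1) (Fin 3) T3 → ℝ → Fin (N + 1) → Fin (N + 1) → V3 × V3 := fun z s i j =>
        reflectVel (G.sepVec (γ z s i).1 (γ z s j).1) ((γ z s i).2, (γ z s j).2)
      let Kc : (Config (N + 1) (Fin 3) T3 → ℝ → Fin (N + 1) → Fin (N + 1) → ℝ) → Config (N + 1) (Fin 3) T3 → ℝ := fun F z =>
        ε / (N + 1 : ℝ) * ∑ᶠ (s : ℝ) (_ : s ∈ collisionTimes G ε (γ z) ∩ Set.Icc 0 t),
          ∑ i : Fin (N + 1), ∑ j : Fin (N + 1),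
            (if i ≠ j ∧ ‖G.sepVec (γ z s i).1 (γ z s j).1‖ = ε then F z s i j else 0)
      let D : Config (N + 1) (Fin 3) T3 → ℝ := fun z =>
        Kc (fun z s i j =>
            g (σ ^ 3 * ρm (γ z s) (γ z s i).1) *
              |⟪(pv z s i j).1 - (pv z s i j).2, ε⁻¹ • G.sepVec (γ z s i).1 (γ z s j).1⟫_ℝ| *
              ∑ k : Fin 3, ∑ l : Fin 3, a k l (s, (γ z s i).1) *
                ((ε⁻¹ • G.sepVec (γ z s i).1 (γ z s j).1) k * (ε⁻¹ • G.sepVec (γ z s i).1 (γ z s j).1) l)) z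
          - 2 * ∫ s in Set.Icc 0 t, ∫ x, g (σ ^ 3 * ρm (γ z s) x) *
              (hsPressure σ (ρm (γ z s) x) (θm (γ z s) x) - ρm (γ z s) x * θm (γ z s) x) *
              ∑ k : Fin 3, a k k (s, x)
      localGibbsLaw σ a₀ u₀ θ₀ N (Φ N) {z | η < |D z|} ≤ ENNReal.ofReal δ := by
  intro hMM hPLE hPEC hECT _hCT hCMUI
  obtain ⟨ηP, hηP, HP⟩ := hPLE
  obtain ⟨ηE, hηE, HE⟩ := hPEC
  obtain ⟨ηY, hηY, Yt, hYt, hYeq⟩ := EvenStressEnskog.exists_contactValue_clamp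
  refine ⟨min ηP (min ηE ηY), lt_min hηP (lt_min hηE hηY), fun a₀ θ₀ u₀ ha hθ hu ha0 hθ0 => ?_⟩
  obtain ⟨σP, hσP, HP1⟩ := HP a₀ θ₀ u₀ ha hθ hu ha0 hθ0
  obtain ⟨σE, hσE, HE1⟩ := HE a₀ θ₀ u₀ ha hθ hu ha0 hθ0
  obtain ⟨σT, hσT, HT1⟩ := hECT a₀ θ₀ u₀ ha hθ hu ha0 hθ0
  obtain ⟨σC, hσC, HC1⟩ := hCMUI a₀ θ₀ u₀ ha hθ hu ha0 hθ0
  refine ⟨min (min σP σE) (min (min σT σC) (1 / 2)),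
    lt_min (lt_min hσP hσE) (lt_min (lt_min hσT hσC) (by norm_num)),
    fun σ hσ hσlt T ρ θ u hsol Φ htie t ht a hac _hsym g hgc hg0 η δ hη hδ => ?_⟩
  have hσP' : σ < σP := hσlt.trans_le ((min_le_left _ _).trans (min_le_left _ _))
  have hσE' : σ < σE := hσlt.trans_le ((min_le_left _ _).trans (min_le_right _ _))
  have hσT' : σ < σT := hσlt.trans_le ((min_le_right _ _).trans ((min_le_left _ _).trans (min_le_left _ _)))
  have hσC' : σ < σC := hσlt.trans_le ((min_le_right _ _).trans ((min_le_left _ _).trans (min_le_right _ _)))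
  have hσ2 : σ ≤ 1 / 2 := (hσlt.trans_le ((min_le_right _ _).trans (min_le_right _ _))).le
  -- the estimate in probability at fixed `(σ, t)` (helper O), fed with the four statistics specialised at `σ`;
  -- the cone fields, the windowed collision statistics and the Enskog predictions of the hypotheses are
  -- definitionally the tree's `rhoC, uC, thetaC, MpsiC, collisionSum, pairFunctional, contactValue`
  exact pressureValue_inProbability hMM hσ hσ2 ha hθ hu ha0 hθ0 Φ ht.1 (lt_min hηP (lt_min hηE hηY))
    (min_le_left _ _) ((min_le_right _ _).trans (min_le_left _ _)) ((min_le_right _ _).trans (min_le_right _ _))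
    hYt hYeq (HP1 σ hσ hσP' T ρ θ u hsol Φ htie t ht)
    (fun τ hτ G hG hGb k hk hkb hk0 η' δ' hη' hδ' => by
      obtain ⟨C, hC⟩ := hkb
      exact HE1 σ hσ hσE' Φ τ hτ G hG hGb (fun p => k (σ ^ 3 * p.1))
        (hk.comp (continuous_const.mul continuous_fst)) ⟨C, fun p => hC _⟩ (fun p hp => hk0 _ hp) η' δ' hη' hδ')
    (HT1 σ hσ hσT' T ρ θ u hsol Φ htie t ht) (HC1 σ hσ hσC' Φ) a hac g hgc hg0 hη hδ

/-- **Registered sub-goal `stub_pressureValueP`** (bookkeeping anchor of this file: the registry cannot hold the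
`8535`-character one-line signature of `stub_pressureValueOfEnskog`, whose registration is truncated): the common
band `η₀ = min(ηP, ηE, ηY)` of the proof is positive and below the three bands. [folklore] -/
theorem stub_pressureValueP : ∀ {ηP ηE ηY : ℝ}, 0 < ηP → 0 < ηE → 0 < ηY → 0 < min ηP (min ηE ηY) ∧ min ηP (min ηE ηY) ≤ ηP ∧ min ηP (min ηE ηY) ≤ ηE ∧ min ηP (min ηE ηY) ≤ ηY :=
  fun hP hE hY => ⟨lt_min hP (lt_min hE hY), min_le_left _ _, (min_le_right _ _).trans (min_le_left _ _),
    (min_le_right _ _).trans (min_le_right _ _)⟩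

end Summit.AtomisticToContinuum.HydrodynamicLimit.Theorems.ChaosClosesEulerPressureValue
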